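import Mathlib.Algebra.Polynomial.Roots
import Literature.Computability.AlgebraicComplexity.GKSS19Claim23
import Literature.Computability.AlgebraicComplexity.GKSS19DerivativeCost
import Literature.Computability.AlgebraicComplexity.GKSS19HardnessToHittingSets
import HarnessLib

/-!
# Guo–Kumar–Saptharishi–Solomon 2019, §3 "Preprocessing the circuit": from a nonzero annihilator
# `C` of `G_P` to a non-degenerate one in the fewest variables

Cell `val-lit`, seat t19 (literature-prover); groundwork for the discharge programme of
`GKSS2019_mainThm` (v2, erratum A34) along the printed proof of [GKSS19, §3]. THEOREM-ONLY (no
definitions, no named facts); nothing here bears on `VP ≠ VNP`, which is NOT proved.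

Source: Z. Guo, M. Kumar, R. Saptharishi, N. Solomon, *Derandomization from algebraic hardness*,
SIAM J. Comput. 51 (2022) = arXiv:1905.00091 [GuoKumarSaptharishiSolomon2019], §3 up to the
definition of `C'` (held text `paper:arxiv-1905.00091`, p0011.txt:L5–L43): "Let `C(x_0, …, x_n)` be
a nonzero polynomial of degree at most `D` … `C` depends on `x_n` … minimality … Claim 23 …
`C' = ∂_{x_n^i}(C)` … is a nonzero polynomial … such that `C' ∘ G_P = 0` and `∂_{x_n}(C') ∘ G_P ≠ 0`.
By interpolation, its size `s' ≤ s·D`."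

## What is here

* `eval_aeval_keepVar'`, `natDegree_aeval_keepVar_le`, `exists_subst_natCast_ne_zero` — Case 1 of
  Claim 23 ("`C(x_0, …, x_{n-1}, a)` … also nonzero for some value of `a ∈ F`", p0011.txt:L25–L29;
  in characteristic `0` some `a ∈ {0, …, D}` works);
* `iterate_pderiv_eq_zero_of_degreeOf_lt` — `∂_{x_m^j} C = 0` for `j > deg_{x_m} C`;
* **`preprocessing`** — for `Q ≠ 0` of degree `≤ D` and complexity `≤ s` with `Q(Δ_0(P), …, Δ_n(P)) = 0`
  there are `m ≤ n` and `Q'' ∈ F[x_0, …, x_m]` of complexity `≤ (D+1)(s+2) + (D+1) + 1` with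
  `Q''(Δ_0(P), …, Δ_m(P)) = 0` and `(∂_{x_m} Q'')(Δ_0(P), …, Δ_m(P)) ≠ 0` (the printed `C'`, in the
  variables it depends on; the minimality of the print is an induction on `#vars`).

## References
* [GuoKumarSaptharishiSolomon2019] arXiv:1905.00091, §3 (p0011.txt:L5–43).
-/

noncomputable section

open MvPolynomial

namespace Literature.Computability.AlgebraicComplexity

namespace GKSS2019

universe u v w

section General

variable {F : Type u} [Field F] {S : Type v} [CommRing S] [Algebra F S] {τ : Type w} [DecidableEq τ]

/-- `Ĉ(t) = C(g_0, …, g_{m-1}, t, …)`: evaluating the kept variable at any `t`.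
[cite: GuoKumarSaptharishiSolomon2019, Claim 23 proof (arXiv p0011.txt:L22-29)] -/
theorem eval_aeval_keepVar' (G : τ → S) (m : τ) (t : S) (Q : MvPolynomial τ F) :
    Polynomial.eval t
        (aeval (fun i => if i = m then (Polynomial.X : Polynomial S) else Polynomial.C (G i)) Q) =
      aeval (Function.update G m t) Q := by
  induction Q using MvPolynomial.induction_on with
  | C c =>
    rw [MvPolynomial.algHom_C, MvPolynomial.algHom_C, Polynomial.algebraMap_apply, Polynomial.eval_C]
  | add p q hp hq => rw [map_add, map_add, Polynomial.eval_add, hp, hq]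
  | mul_X p i hp =>
    rw [map_mul, map_mul, Polynomial.eval_mul, hp, aeval_X, aeval_X]
    by_cases him : i = m
    · subst him; simp
    · rw [if_neg him, Polynomial.eval_C, Function.update_of_ne him]

/-- The degree of `Ĉ` in the kept variable is at most `deg_{x_m} C`.
[cite: GuoKumarSaptharishiSolomon2019, Claim 23 proof (arXiv p0011.txt:L30-31), "`r = deg_{x_n}(Ĉ)`"] -/
theorem natDegree_aeval_keepVar_le (G : τ → S) (m : τ) (Q : MvPolynomial τ F) :
    (aeval (fun i => if i = m then (Polynomial.X : Polynomial S) else Polynomial.C (G i))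
      Q).natDegree ≤ degreeOf m Q := by
  classical
  set φ : τ → Polynomial S := fun i =>
    if i = m then (Polynomial.X : Polynomial S) else Polynomial.C (G i) with hφ
  have hφdeg : ∀ i, (φ i).natDegree ≤ if i = m then 1 else 0 := by
    intro i
    by_cases him : i = m
    · subst him
      simp only [hφ, if_true]
      exact Polynomial.natDegree_X_le
    · simp [hφ, if_neg him]
  conv_lhs => rw [Q.as_sum, map_sum]
  refine Polynomial.natDegree_sum_le_of_forall_le _ _ fun e he => ?_
  rw [aeval_monomial, Polynomial.algebraMap_apply]
  refine (Polynomial.natDegree_C_mul_le _ _).trans ?_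
  rw [Finsupp.prod]
  refine (Polynomial.natDegree_prod_le _ _).trans ?_
  calc ∑ i ∈ e.support, (φ i ^ e i).natDegree
      ≤ ∑ i ∈ e.support, e i * (if i = m then 1 else 0) :=
        Finset.sum_le_sum fun i _ => (Polynomial.natDegree_pow_le).trans
          (Nat.mul_le_mul_left _ (hφdeg i))
    _ = ∑ i ∈ e.support, (if i = m then e i else 0) :=
        Finset.sum_congr rfl fun i _ => by split_ifs <;> simp
    _ ≤ e m := by
        rw [Finset.sum_ite_eq' e.support m (fun i => e i)]
        split_ifs <;> simp
    _ ≤ degreeOf m Q := by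
        rw [degreeOf_eq_sup]
        exact Finset.le_sup (f := fun d : τ →₀ ℕ => d m) he

end General

variable {F : Type u} [Field F]

/-- **Case 1 of Claim 23, the choice of `a`**: a nonzero `Q` with `deg_{x_m} Q ≤ D` stays nonzero
under `x_m := a` for some `a ∈ {0, …, D}` (characteristic `0`; "since `C` is nonzero, this
remains so for some `a`"). [cite: GuoKumarSaptharishiSolomon2019, Claim 23 proof (arXiv p0011.txt:L25-29)] -/
theorem exists_subst_natCast_ne_zero [CharZero F] {τ : Type w} [DecidableEq τ] {Q : MvPolynomial τ F}
    (hQ : Q ≠ 0) (m : τ) {D : ℕ} (hdeg : degreeOf m Q ≤ D) :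
    ∃ a : Fin (D + 1), aeval (Function.update X m (C ((a : ℕ) : F))) Q ≠ 0 := by
  by_contra hcon
  simp only [not_exists, not_not] at hcon
  set Qt := aeval (fun i => if i = m then (Polynomial.X : Polynomial (MvPolynomial τ F))
    else Polynomial.C (X i)) Q with hQt
  have hzero : Qt = 0 := by
    refine Polynomial.eq_zero_of_natDegree_lt_card_of_eval_eq_zero Qt
      (f := fun a : Fin (D + 1) => (C ((a : ℕ) : F) : MvPolynomial τ F)) ?_ ?_ ?_
    · intro a b hab
      have h := (C_injective τ F) hab
      exact Fin.ext (Nat.cast_injective (R := F) h)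
    · intro a
      rw [hQt, eval_aeval_keepVar']
      exact hcon a
    · rw [Fintype.card_fin]
      exact Nat.lt_succ_of_le ((natDegree_aeval_keepVar_le X m Q).trans hdeg)
  apply hQ
  have h := eval_aeval_keepVar' (X : τ → MvPolynomial τ F) m (X m) Q
  rw [← hQt, hzero, Polynomial.eval_zero, Function.update_eq_self, aeval_X_left_apply] at h
  exact h.symm

/-- `∂_{x_m^j} Q = 0` once `j > deg_{x_m} Q`. [cite: GuoKumarSaptharishiSolomon2019, Claim 23 proof (arXiv p0011.txt:L30-40)] -/
theorem iterate_pderiv_eq_zero_of_degreeOf_lt {τ : Type w} [DecidableEq τ] (m : τ)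
    (Q : MvPolynomial τ F) {j : ℕ} (hj : degreeOf m Q < j) : (pderiv m)^[j] Q = 0 := by
  rw [iterate_pderiv_eq_factorial_mul_coeff,
    Polynomial.coeff_eq_zero_of_natDegree_lt ((natDegree_aeval_taylorVar_le m Q).trans_lt hj),
    mul_zero]

/-- Total degree does not increase under substituting a constant for one variable.
[cite: GuoKumarSaptharishiSolomon2019, Claim 23 proof (arXiv p0011.txt:L25-29)] -/
theorem totalDegree_subst_C_le {τ : Type w} [DecidableEq τ] (m : τ) (a : F) (Q : MvPolynomial τ F) :
    (aeval (Function.update X m (C a)) Q).totalDegree ≤ Q.totalDegree := by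
  classical
  have hφ : ∀ i, (Function.update (X : τ → MvPolynomial τ F) m (C a) i).totalDegree ≤ 1 := by
    intro i
    by_cases him : i = m
    · subst him; simp
    · rw [Function.update_of_ne him, totalDegree_X]
  conv_lhs => rw [Q.as_sum]
  rw [map_sum]
  refine totalDegree_finsetSum_le fun e he => ?_
  rw [aeval_monomial]
  refine (totalDegree_mul _ _).trans ?_
  rw [← C_eq_algebraMap, totalDegree_C, zero_add, Finsupp.prod]
  refine (totalDegree_finsetProd _ _).trans ?_
  calc ∑ i ∈ e.support, (Function.update (X : τ → MvPolynomial τ F) m (C a) i ^ e i).totalDegree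
      ≤ ∑ i ∈ e.support, e i := Finset.sum_le_sum fun i _ =>
        (totalDegree_pow _ _).trans ((Nat.mul_le_mul_left _ (hφ i)).trans (by simp))
    _ ≤ Q.totalDegree := by
        have h := le_totalDegree he
        rwa [Finsupp.sum] at h

/-- Substituting a constant for a variable it removes it from `vars`.
[cite: GuoKumarSaptharishiSolomon2019, Claim 23 proof (arXiv p0011.txt:L25-29), "depends on one fewer variable"] -/
theorem vars_subst_C_subset {τ : Type w} [DecidableEq τ] (m : τ) (a : F) (Q : MvPolynomial τ F) :
    (aeval (Function.update X m (C a)) Q).vars ⊆ Q.vars.erase m := by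
  rw [show aeval (Function.update (X : τ → MvPolynomial τ F) m (C a)) Q =
    bind₁ (Function.update X m (C a)) Q from by rw [aeval_eq_bind₁]]
  refine (vars_bind₁ _ _).trans (Finset.biUnion_subset.mpr fun i hi => ?_)
  by_cases him : i = m
  · subst him; simp
  · rw [Function.update_of_ne him, vars_X]
    exact Finset.singleton_subset_iff.mpr (Finset.mem_erase.mpr ⟨him, hi⟩)

/-- Substitutions by variables and constants are free. [cite: Burgisser2000, Rem. 2.7] -/
theorem complexity_subst_C_le {τ : Type w} [DecidableEq τ] [Fintype τ] (m : τ) (a : F)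
    (Q : MvPolynomial τ F) : complexity (aeval (Function.update X m (C a)) Q) ≤ complexity Q := by
  refine (complexity_aeval_le Q _).trans ?_
  have h : ∑ i, complexity (Function.update (X : τ → MvPolynomial τ F) m (C a) i) = 0 := by
    refine Finset.sum_eq_zero fun i _ => ?_
    by_cases him : i = m
    · subst him
      rw [Function.update_self]
      exact complexity_C_holds a
    · rw [Function.update_of_ne him]
      exact complexity_X_holds i
  omega

variable [CharZero F] {k : ℕ}

/-- **Preprocessing (GKSS §3 up to `C'`).** Let `Q ≠ 0` have degree `≤ D` and complexity `≤ s`,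
with `Q(Δ_0(P), …, Δ_n(P)) = 0`. Then for some `m ≤ n` there is `Q'' ∈ F[x_0, …, x_m]` of
complexity `≤ (D+1)(s+2) + (D+1) + 1` with `Q''(Δ_0(P), …, Δ_m(P)) = 0` and
`(∂_{x_m} Q'')(Δ_0(P), …, Δ_m(P)) ≠ 0` — the print's `C' = ∂_{x_n^i}(C)` after discarding the
variables `C` does not depend on (minimality = induction on the number of variables: Case 1 of
Claim 23 substitutes `x_n := a` and recurses, Case 2 applies `claim23`; "by interpolation, its size
`s' ≤ s·D`" is `complexity_iterate_pderiv_le`).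
[cite: GuoKumarSaptharishiSolomon2019, §3 (arXiv p0011.txt:L5-43)] -/
theorem preprocessing {n D s : ℕ} (P : MvPolynomial (Fin k) F) :
    ∀ (N : ℕ) (Q : MvPolynomial (Fin (n + 1)) F), Q.vars.card ≤ N → Q ≠ 0 →
      Q.totalDegree ≤ D → complexity Q ≤ s → aeval (gen P n) Q = 0 →
      ∃ m, m ≤ n ∧ ∃ Q'' : MvPolynomial (Fin (m + 1)) F,
        complexity Q'' ≤ (D + 1) * (s + 2) + (D + 1) + 1 ∧
        aeval (gen P m) Q'' = 0 ∧ aeval (gen P m) (pderiv (Fin.last m) Q'') ≠ 0 := by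
  intro N
  induction N with
  | zero =>
    -- no variables: `Q` is a nonzero constant, contradiction
    intro Q hcard hQ _ _ hroot
    exfalso
    have hvars : (↑Q.vars : Set (Fin (n + 1))) ⊆ Set.range (Fin.elim0 : Fin 0 → Fin (n + 1)) := by
      rw [Finset.card_eq_zero.mp (Nat.le_zero.mp hcard)]
      simp
    obtain ⟨q, hq⟩ := exists_rename_eq_of_vars_subset_range Q Fin.elim0
      (fun i => Fin.elim0 i) hvars
    rw [eq_C_of_isEmpty q, rename_C] at hq
    rw [← hq, MvPolynomial.algHom_C, MvPolynomial.algebraMap_eq, C_eq_zero] at hroot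
    exact hQ (by rw [← hq, hroot, C_0])
  | succ N ih =>
    intro Q hcard hQ hdeg hs hroot
    by_cases hle : Q.vars.card ≤ N
    · exact ih Q hle hQ hdeg hs hroot
    have hne : Q.vars.Nonempty := by
      rw [← Finset.card_pos]; omega
    -- the largest variable `x_m` occurring in `Q`
    set m' : Fin (n + 1) := Q.vars.max' hne with hm'
    set m : ℕ := (m' : ℕ) with hm
    have hmn : m ≤ n := by have := m'.isLt; omega
    have hmle : m + 1 ≤ n + 1 := by omega
    set ι : Fin (m + 1) → Fin (n + 1) := Fin.castLE hmle with hι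
    have hιinj : Function.Injective ι := Fin.castLE_injective hmle
    have hιlast : ι (Fin.last m) = m' := Fin.ext (by simp [hι, hm])
    have hvars : (↑Q.vars : Set (Fin (n + 1))) ⊆ Set.range ι := by
      intro j hj
      have hjm : j ≤ m' := Finset.le_max' _ j hj
      refine ⟨⟨j, by rw [Fin.le_def] at hjm; omega⟩, Fin.ext ?_⟩
      simp [hι]
    obtain ⟨Q₀, hQ₀⟩ := exists_rename_eq_of_vars_subset_range Q ι hιinj hvars
    -- a left inverse of `ι`, to compare degrees and complexities of `Q₀` and `Q`
    set π : Fin (n + 1) → Fin (m + 1) := fun j =>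
      if h : (j : ℕ) ≤ m then ⟨j, Nat.lt_succ_of_le h⟩ else Fin.last m with hπ
    have hπι : π ∘ ι = id := by
      funext i
      have hi : ((ι i : Fin (n + 1)) : ℕ) ≤ m := by simp [hι]; omega
      simp only [Function.comp_apply, hπ, dif_pos hi, id_eq]
      exact Fin.ext (by simp [hι])
    have hQ₀eq : Q₀ = rename π Q := by
      rw [← hQ₀, rename_rename, hπι, rename_id]
      rfl
    have hgen : gen P n ∘ ι = gen P m := by
      funext i
      simp [gen, hι]
    have hroot₀ : aeval (gen P m) Q₀ = 0 := by
      rw [← hgen, ← aeval_rename, hQ₀, hroot]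
    have hdeg₀ : degreeOf (Fin.last m) Q₀ ≤ D :=
      (degreeOf_le_totalDegree _ _).trans
        ((by rw [hQ₀eq]; exact totalDegree_rename_le _ _ : Q₀.totalDegree ≤ Q.totalDegree).trans
          hdeg)
    have hs₀ : complexity Q₀ ≤ s := by
      rw [hQ₀eq]; exact (complexity_rename_le_holds' π Q).trans hs
    -- `Ĉ`, the univariate specialisation in the kept variable `x_m`, over `S = F[z ⊔ y]`
    set Ch := aeval (fun i : Fin (m + 1) => if i = Fin.last m
      then (Polynomial.X : Polynomial (MvPolynomial (Fin k ⊕ Fin k) F))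
      else Polynomial.C (gen P m i)) Q₀ with hCh
    by_cases hC : Ch = 0
    · -- Case 1: `Ĉ = 0`; substitute `x_m := a` with `Q(…, a, …) ≠ 0` and recurse
      obtain ⟨a, ha⟩ := exists_subst_natCast_ne_zero hQ m'
        ((degreeOf_le_totalDegree _ _).trans hdeg)
      set Qa := aeval (Function.update X m' (C ((a : ℕ) : F))) Q with hQa
      have hcardQa : Qa.vars.card ≤ N := by
        have h1 := Finset.card_le_card (vars_subst_C_subset m' ((a : ℕ) : F) Q)
        rw [Finset.card_erase_of_mem (Finset.max'_mem _ hne)] at h1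
        rw [hQa]; omega
      have hrootQa : aeval (gen P n) Qa = 0 := by
        set t : MvPolynomial (Fin k ⊕ Fin k) F := algebraMap F _ ((a : ℕ) : F) with ht
        have hupd : (fun i => aeval (gen P n) (Function.update (X : Fin (n + 1) →
            MvPolynomial (Fin (n + 1)) F) m' (C ((a : ℕ) : F)) i)) =
            Function.update (gen P n) m' t := by
          funext i
          by_cases him : i = m'
          · subst him; simp [ht]
          · rw [Function.update_of_ne him, Function.update_of_ne him, aeval_X]
        rw [hQa, comp_aeval_apply, hupd, ← hQ₀, aeval_rename, ← hιlast,
          Function.update_comp_eq_of_injective _ hιinj, hgen, ← eval_aeval_keepVar', ← hCh, hC,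
          Polynomial.eval_zero]
      exact ih Qa hcardQa ha ((totalDegree_subst_C_le _ _ _).trans hdeg)
        ((complexity_subst_C_le _ _ _).trans hs) hrootQa
    · -- Case 2: `Ĉ ≠ 0`; Claim 23 gives the order `i`, and `Q'' = ∂_{x_m^i} Q₀`
      obtain ⟨i, hi0, hi1⟩ := claim23 (gen P m) (Fin.last m) Q₀ hroot₀ hC
      have hiD : i ≤ D := by
        by_contra hcon
        apply hi1
        rw [iterate_pderiv_eq_zero_of_degreeOf_lt (Fin.last m) Q₀ (by omega), map_zero]
      refine ⟨m, hmn, (pderiv (Fin.last m))^[i] Q₀, ?_, hi0, ?_⟩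
      · calc complexity ((pderiv (Fin.last m))^[i] Q₀)
            ≤ (D + 1) * (complexity Q₀ + 2) + (D + 1) + 1 :=
              complexity_iterate_pderiv_le (Fin.last m) Q₀ hdeg₀ hiD
          _ ≤ (D + 1) * (s + 2) + (D + 1) + 1 := by
              have := Nat.mul_le_mul_left (D + 1) (Nat.add_le_add_right hs₀ 2)
              omega
      · rwa [← Function.iterate_succ_apply' (pderiv (Fin.last m))]

end GKSS2019

end Literature.Computability.AlgebraicComplexity
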